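import Mathlib
import HarnessLib
import Summits.CriticalPhenomena.PercolationContinuityZ3.Theses.PercTreeValue
import Summits.CriticalPhenomena.PercolationContinuityZ3.Theorems.PercTreeValueTetrahedronHarrisGapStubCondHarris
import Summits.CriticalPhenomena.PercolationContinuityZ3.Theorems.PercTreeValueTetrahedronHarrisGapStubG
import Literature.Probability.Percolation.BlockResampling
import Literature.Probability.Percolation.InfiniteClusterDensity
import Literature.Probability.Percolation.TwoPointFunction
import Literature.Probability.Percolation.PercolationProofs

/-!
# Crux `TetrahedronHarrisGap` (stmt-CriticalPhenomena-7799), line `SketchIdeator1` rev 5: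
# blocking ∧ coherence ⟹ crux (the coherence reduction)

Line `SketchIdeator1` (card `corner-ball-total-covariance`; skeleton `Cruxes/TetrahedronHarrisGap/Lines/SketchIdeator1.lean`,
rev 5, lead prover-line-stmt-CriticalPhenomena-7799-c1-0).  This file lands the registered sub-goal
`crux_of_block_of_coherence` of the crux item: the crux
`Summit.CriticalPhenomena.PercolationContinuityZ3.Theses.PercTreeValue.TetrahedronHarrisGap`
(`∃ δ > 0, ∃ r₀, ∀ r ≥ r₀, (1+δ) τ(0,a_r) τ(b_r,c_r) ≤ P_{p_c}(0 ↔ a_r ∧ b_r ↔ c_r)`, `a_r = (r,r,0)`, `b_r = (r,0,r)`,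
`c_r = (0,r,r)`) follows from TWO inputs, both stated over the tree's written-out conditional probabilities
`f_r = P(0 ↔ a_r | ω off K_r)`, `g_r = P(b_r ↔ c_r | ω off K_r)` (`blockCondProb`, BlockResampling.lean; `K_r` = the
lattice edges touching the four corner boxes of sup-radius `r/8`):

* blocking `stub_block`: `P(f_r = 0), P(g_r = 0) ≥ c_B` (a corollary of `PercAnnulusCrossing.CritAnnulusNonCrossing`,
  stmt-CriticalPhenomena-0846, landed as `stub_block_of_critAnnulusNonCrossing`);
* coherence `stub_coherence`: `c · Var f_r ≤ Cov(f_r, g_r)` (OPEN; the line's single transfer statement).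

Proof (`δ = c · c_B`): `P(A ∩ B) ≥ ∫ f g dP` (conditional Harris inside the corner block, `stub_condHarris`);
`∫ f = τ_A`, `∫ g = τ_B` (tower property `integral_blockCondProb_eq`); `∫ f g ≥ τ_A τ_B + c · Var f` (coherence);
`Var f = ∫ (f − τ_A)² ≥ τ_A² P(f = 0) ≥ c_B τ_A²` (blocking); `τ_B = τ_A` (`tau_opposite_edge_eq`).  Compared with the
rev-4 reduction `crux_of_open_stubs` (`…Reduction.lean`: gluing-lite ∧ blocking ∧ level-set relative gap ⟹ crux) this
asks strictly less of `ℤ³`: the rev-4 inputs imply coherence (skeleton stub `stub_coherence_of_cornerBallInputs`), and the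
"influence variance" lower bound `Var f_r ≥ c_B τ²` (ideator 2's `InfluenceVariance` for this window) is free from
blocking.  No new definitions; sorry-free; the two inputs are HYPOTHESES (a reduction, not a proof of the crux).
-/

noncomputable section

open MeasureTheory Filter Set
open Literature.Probability.Percolation Literature.Probability.LatticeModels

namespace Summit.CriticalPhenomena.PercolationContinuityZ3.Theorems.TetrahedronHarrisGap

/-- **crux_of_block_of_coherence** (registered sub-goal of stmt-CriticalPhenomena-7799; the rev-5 composition of line
`SketchIdeator1`). Blocking (`stub_block`) and coherence (`stub_coherence`) imply the crux `TetrahedronHarrisGap`, with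
`δ = c · c_B`:
`P(A ∩ B) ≥ ∫ f g` (conditional Harris in the corner block, `stub_condHarris`) `≥ τ_A τ_B + c · Var f`
(coherence; `∫ f = τ_A`, `∫ g = τ_B` by the tower property) `≥ τ_A τ_B + c c_B τ_A²` (`Var f ≥ P(f = 0) τ_A²`)
`= (1 + c c_B) τ_A τ_B` (`τ_B = τ_A`, `tau_opposite_edge_eq`).  Hypotheses are the two stub texts with `K`, `f`, `g`
`let`-bound (definitionally the registered signatures). -/
theorem crux_of_block_of_coherence :
    (∃ c_B : ℝ, 0 < c_B ∧ ∃ r₀ : ℕ, ∀ r : ℕ, r₀ ≤ r →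
      let K : Finset (Sym2 (Site 3)) :=
        armEdges (r / 8) (0 : Site 3) ∪ armEdges (r / 8) ![(r : ℤ), (r : ℤ), 0] ∪
          armEdges (r / 8) ![(r : ℤ), 0, (r : ℤ)] ∪ armEdges (r / 8) ![0, (r : ℤ), (r : ℤ)];
      let f : BondConfig (Site 3) → ℝ :=
        blockCondProb (zdGraph 3) (criticalProbI 3) K (openConn (0 : Site 3) ![(r : ℤ), (r : ℤ), 0]);
      let g : BondConfig (Site 3) → ℝ :=
        blockCondProb (zdGraph 3) (criticalProbI 3) K (openConn ![(r : ℤ), 0, (r : ℤ)] ![0, (r : ℤ), (r : ℤ)]);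
      c_B ≤ (bondPercolation (zdGraph 3) (criticalProbI 3)).real {ω | f ω = 0} ∧
        c_B ≤ (bondPercolation (zdGraph 3) (criticalProbI 3)).real {ω | g ω = 0}) →
    (∃ c : ℝ, 0 < c ∧ ∃ r₀ : ℕ, ∀ r : ℕ, r₀ ≤ r →
      let K : Finset (Sym2 (Site 3)) :=
        armEdges (r / 8) (0 : Site 3) ∪ armEdges (r / 8) ![(r : ℤ), (r : ℤ), 0] ∪
          armEdges (r / 8) ![(r : ℤ), 0, (r : ℤ)] ∪ armEdges (r / 8) ![0, (r : ℤ), (r : ℤ)];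
      let f : BondConfig (Site 3) → ℝ :=
        blockCondProb (zdGraph 3) (criticalProbI 3) K (openConn (0 : Site 3) ![(r : ℤ), (r : ℤ), 0]);
      let g : BondConfig (Site 3) → ℝ :=
        blockCondProb (zdGraph 3) (criticalProbI 3) K (openConn ![(r : ℤ), 0, (r : ℤ)] ![0, (r : ℤ), (r : ℤ)]);
      c * (∫ ω, f ω ^ 2 ∂(bondPercolation (zdGraph 3) (criticalProbI 3)) -
            (∫ ω, f ω ∂(bondPercolation (zdGraph 3) (criticalProbI 3))) ^ 2) ≤
        ∫ ω, f ω * g ω ∂(bondPercolation (zdGraph 3) (criticalProbI 3)) -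
          (∫ ω, f ω ∂(bondPercolation (zdGraph 3) (criticalProbI 3))) *
            (∫ ω, g ω ∂(bondPercolation (zdGraph 3) (criticalProbI 3)))) →
    Summit.CriticalPhenomena.PercolationContinuityZ3.Theses.PercTreeValue.TetrahedronHarrisGap := by
  intro hBl hCoh
  classical
  obtain ⟨cB, hcB, r₁, hBl⟩ := hBl
  obtain ⟨c, hc, r₂, hCoh⟩ := hCoh
  unfold Summit.CriticalPhenomena.PercolationContinuityZ3.Theses.PercTreeValue.TetrahedronHarrisGap
  refine ⟨c * cB, by positivity, max r₁ r₂, fun r hr => ?_⟩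
  have hr₁ : r₁ ≤ r := le_trans (le_max_left _ _) hr
  have hr₂ : r₂ ≤ r := le_trans (le_max_right _ _) hr
  have hBl' := hBl r hr₁
  have hCoh' := hCoh r hr₂
  dsimp only at hBl' hCoh'
  clear hBl hCoh
  -- names
  set P : Measure (BondConfig (Site 3)) := bondPercolation (zdGraph 3) (criticalProbI 3) with hP
  set K : Finset (Sym2 (Site 3)) :=
    armEdges (r / 8) (0 : Site 3) ∪ armEdges (r / 8) ![(r : ℤ), (r : ℤ), 0] ∪
      armEdges (r / 8) ![(r : ℤ), 0, (r : ℤ)] ∪ armEdges (r / 8) ![0, (r : ℤ), (r : ℤ)] with hK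
  set A : Set (BondConfig (Site 3)) := openConn (0 : Site 3) ![(r : ℤ), (r : ℤ), 0] with hA
  set B : Set (BondConfig (Site 3)) := openConn ![(r : ℤ), 0, (r : ℤ)] ![0, (r : ℤ), (r : ℤ)] with hB
  set f : BondConfig (Site 3) → ℝ := blockCondProb (zdGraph 3) (criticalProbI 3) K A with hf
  set g : BondConfig (Site 3) → ℝ := blockCondProb (zdGraph 3) (criticalProbI 3) K B with hg
  -- basic facts about `A`, `B`, `f`, `g`
  have hAm : MeasurableSet A := measurableSet_openConn_holds _ _
  have hBm : MeasurableSet B := measurableSet_openConn_holds _ _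
  have hAu : IsUpperSet A := isUpperSet_openConn _ _
  have hBu : IsUpperSet B := isUpperSet_openConn _ _
  have hfm : Measurable f := measurable_blockCondProb _ _ K hAm
  have hf0 : ∀ ω, 0 ≤ f ω := fun ω => blockCondProb_nonneg _ _ K A ω
  have hf1 : ∀ ω, f ω ≤ 1 := fun ω => blockCondProb_le_one _ _ K A ω
  have hfi : Integrable f P := by
    simpa [hP] using
      (Summit.CriticalPhenomena.PercolationContinuityZ3.Theorems.TetrahedronHarrisGap.integrable_blockCondProb
        (zdGraph 3) (criticalProbI 3) K hAm)
  have hf2i : Integrable (fun ω => f ω ^ 2) P := by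
    refine Integrable.of_bound (hfm.pow_const 2).aestronglyMeasurable 1 (ae_of_all _ fun ω => ?_)
    rw [Real.norm_eq_abs, abs_of_nonneg (sq_nonneg _)]
    nlinarith [hf0 ω, hf1 ω]
  -- the two-point functions are the means of `f`, `g`, and they coincide
  have hτA : tau 3 (criticalProbI 3) 0 ![(r : ℤ), (r : ℤ), 0] = ∫ ω, f ω ∂P := by
    rw [tau_def, hf,
      Summit.CriticalPhenomena.PercolationContinuityZ3.Theorems.TetrahedronHarrisGap.integral_blockCondProb_eq
        _ _ K hAm]
  have hτB : tau 3 (criticalProbI 3) ![(r : ℤ), 0, (r : ℤ)] ![0, (r : ℤ), (r : ℤ)] = ∫ ω, g ω ∂P := by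
    rw [tau_def, hg,
      Summit.CriticalPhenomena.PercolationContinuityZ3.Theorems.TetrahedronHarrisGap.integral_blockCondProb_eq
        _ _ K hBm]
  have hτBA : tau 3 (criticalProbI 3) ![(r : ℤ), 0, (r : ℤ)] ![0, (r : ℤ), (r : ℤ)] =
      tau 3 (criticalProbI 3) 0 ![(r : ℤ), (r : ℤ), 0] :=
    Summit.CriticalPhenomena.PercolationContinuityZ3.Theorems.TetrahedronHarrisGap.tau_opposite_edge_eq _ r
  set τ : ℝ := tau 3 (criticalProbI 3) 0 ![(r : ℤ), (r : ℤ), 0] with hτ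
  have hτnn : 0 ≤ τ := by rw [hτ, tau_def]; exact measureReal_nonneg
  -- conditional Harris: `∫ f g ≤ P(A ∩ B)`
  have hcond :=
    Summit.CriticalPhenomena.PercolationContinuityZ3.Theorems.TetrahedronHarrisGap.stub_condHarris
      (criticalProbI 3) K A B hAu hBu hAm hBm
  -- variance lower bound from blocking: `∫ f² - τ² ≥ c_B τ²`
  have hmeas0 : MeasurableSet {ω | f ω = 0} := hfm (measurableSet_singleton 0)
  have hVar : cB * τ ^ 2 ≤ ∫ ω, f ω ^ 2 ∂P - τ ^ 2 := by
    -- pointwise: `(f - τ)² ≥ τ² · 1{f = 0}`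
    have hpt : ∀ ω, τ ^ 2 * {ω | f ω = 0}.indicator (fun _ => (1 : ℝ)) ω ≤ (f ω - τ) ^ 2 := by
      intro ω
      by_cases h : f ω = 0
      · rw [Set.indicator_of_mem (show ω ∈ {ω | f ω = 0} from h), mul_one, h]
        ring_nf
        exact le_refl _
      · rw [Set.indicator_of_notMem (show ω ∉ {ω | f ω = 0} from h), mul_zero]
        exact sq_nonneg _
    have hind : Integrable (fun ω => {ω | f ω = 0}.indicator (fun _ => (1 : ℝ)) ω) P :=
      (integrable_const (1 : ℝ)).indicator hmeas0
    have hlin : Integrable (fun ω => 2 * τ * f ω) P := hfi.const_mul (2 * τ)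
    have hquad : Integrable (fun ω => f ω ^ 2 - 2 * τ * f ω) P := hf2i.sub hlin
    have hsqi : Integrable (fun ω => (f ω - τ) ^ 2) P := by
      have : (fun ω => (f ω - τ) ^ 2) = fun ω => f ω ^ 2 - 2 * τ * f ω + τ ^ 2 := by
        funext ω; ring
      rw [this]
      exact hquad.add (integrable_const _)
    have h1 : τ ^ 2 * P.real {ω | f ω = 0} ≤ ∫ ω, (f ω - τ) ^ 2 ∂P := by
      calc τ ^ 2 * P.real {ω | f ω = 0}
          = ∫ ω, τ ^ 2 * {ω | f ω = 0}.indicator (fun _ => (1 : ℝ)) ω ∂P := by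
            rw [integral_const_mul, integral_indicator_const _ hmeas0, smul_eq_mul, mul_one]
        _ ≤ ∫ ω, (f ω - τ) ^ 2 ∂P := integral_mono (hind.const_mul _) hsqi hpt
    have h2 : ∫ ω, (f ω - τ) ^ 2 ∂P = ∫ ω, f ω ^ 2 ∂P - τ ^ 2 := by
      have : (fun ω => (f ω - τ) ^ 2) = fun ω => f ω ^ 2 - 2 * τ * f ω + τ ^ 2 := by
        funext ω; ring
      rw [this, integral_add hquad (integrable_const _), integral_sub hf2i hlin, integral_const_mul,
        integral_const, probReal_univ, one_smul, ← hτA]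
      ring
    have h3 : cB * τ ^ 2 ≤ τ ^ 2 * P.real {ω | f ω = 0} := by
      rw [mul_comm]
      exact mul_le_mul_of_nonneg_left hBl'.1 (sq_nonneg _)
    linarith
  -- coherence, rewritten with `τ`
  have hCoh'' : c * (∫ ω, f ω ^ 2 ∂P - τ ^ 2) ≤ ∫ ω, f ω * g ω ∂P - τ * τ := by
    have h := hCoh'
    rw [← hτA, ← hτB, hτBA] at h
    exact h
  -- assemble
  have hmain : (1 + c * cB) * τ * τ ≤ P.real (A ∩ B) := by
    have h1 : c * (cB * τ ^ 2) ≤ c * (∫ ω, f ω ^ 2 ∂P - τ ^ 2) := mul_le_mul_of_nonneg_left hVar hc.le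
    nlinarith [hcond, hCoh'', h1]
  rw [hτBA]
  exact hmain

end Summit.CriticalPhenomena.PercolationContinuityZ3.Theorems.TetrahedronHarrisGap

end
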